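import Mathlib
import HarnessLib
import Literature.MathematicalPhysics.QuantumLattice.HubbardSpaceTimeCharacters
import Summits.HubbardSuperconductivity.HubbardSuperconductivity.Theorems.KLProgrammeKLRegimeSectorSliceRows
import Summits.HubbardSuperconductivity.HubbardSuperconductivity.Theorems.KLProgrammeKLRegimeTwoVolumeProfileBridge

/-!
# Route `KLProgramme` — engine / VL support (route (L2)), SECTIONAL: the **fixed-time, fixed-label weighted spatial row** of the sectorised
# counterterm slice covariance `Sᵀ(F)·C^K_{(Λ,Λ′]}·S(F)` reduces to ONE fixed-time weighted character-sum `ℓ¹` norm per orientation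

Cell `gate-hubbard-kl`, seat p3 (g12), for the «sectional row `eW′`» in the SECTOR currency: k3c4-p1's blueprint-v5 step
`…TwoVolumeSrcSectorScaleSuccMinS.srcSector_sum_norm_kernel_twoVolume_scaleSucc_minS_le` reads, besides the Λ-scaled weighted rows/columns of the
fine sector covariance, its SECTIONAL Λ-scaled row `hsecW' : ∀ X′ t ℓ, Σ_y ‖C′ X′ ((t,y),ℓ)‖·(1 + Λ·tnorm(x⃗′ − y)) ≤ eW′` (field `ScaleCovSecData.sec` of
`…TwoVolumeSpineDataDefs`).  This file is the sectional twin of `…SectorSliceRowsMoment.rowSumWt_norm_pullback_sliceCT_le` and of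
`…SectorSliceAlphaWtRows.rowSumWt_sliceCT_bgmFat_le_of_pairBound`, with NO analysis:

* §1 **`secRowWt_norm_pullback_sliceCT_le`** — for every nonnegative even weight `w` on the spatial torus, every `X = (x, ((ω,σ),c))`, time slice
  `t` and label `ℓ = ((ω′,σ′),c′)`: if `Σ_{z₂} w(z₂)·‖Σ_q χ_{q₁}(z₁)χ_{q₂}(z₂) • G_{ωω′}(q)‖ ≤ T` for EVERY time difference `z₁`
  (`G_{ωω′}(q) = (βL²)⁻² F_ω(k_q) F_{ω′}(k_q) Ψ̂_{ω(q₁)}(e_K(q₂))`), then `Σ_y ‖(Sᵀ C S) X ((t,y),ℓ)‖·w(x⃗ − y) ≤ 2·T` — one term per orientation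
  (`HubbardSpaceTimeCharacters.norm_pullback_normalCovariance_le`), NO label sum and NO partner-sector sum (the label `ℓ` is fixed);
* §2 **`secRowWt_sliceCT_bgmFat_le_of_pairBound`** — the fat family at angular scale `m+1` with the Λ-scaled site weight `1 + Λ_w·tnorm(x⃗ − y)`
  dominated by the rate weight (`0 ≤ Λ_w ≤ D·s₁`, `1 ≤ D`; `tnorm ≤ |z̃₁| + |z̃₂|`): a uniform rate-weighted sectional per-pair bound `T` gives the
  sectional row `≤ 2·(D·T)`.

Everything is proved; no definitions, no named facts. [folklore] (BGM 2006 §2.7 (2.66)–(2.67), §3 (3.3).)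
-/

noncomputable section

namespace Summit.HubbardSuperconductivity.HubbardSuperconductivity.Theorems.TorusFourierL2

set_option linter.dupNamespace false -- summit = problem name (single-conjunct summit), D-0017

open Finset Complex Literature.MathematicalPhysics.QuantumLattice Literature.Probability.LatticeModels
open Summit.HubbardSuperconductivity.HubbardSuperconductivity.Theorems.TwoVolumeDefect
open scoped Real

/-! ### §1 Generic family: the sectional weighted row is two fixed-time weighted character-sum norms -/

section Generic

variable {L M N : ℕ} [NeZero L] [NeZero M]

/-- **The sectional weighted row of the sectorised zero-seed CT slice covariance**: for every nonnegative even weight `w` on the spatial torus,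
every auxiliary label `X = (x, ((ω,σ),c))`, time slice `t` and label `ℓ = ((ω′,σ′),c′)`, if the `w`-weighted spatial `ℓ¹` norm of the per-pair
character sum `Σ_q χ_{q₁}(z₁)χ_{q₂}(z₂) • G_{ωω′}(q)` is `≤ T` at EVERY time difference `z₁`, then
`Σ_y ‖(Sᵀ C^K_{(Λ,Λ′]} S) X ((t,y),ℓ)‖·w(x⃗ − y) ≤ 2·T` (one term per orientation `(c,c′) ∈ {(+,−),(−,+)}`).
[cite: BenfattoGiulianiMastropietro2006, §2.7 (2.66)–(2.67)] -/
theorem secRowWt_norm_pullback_sliceCT_le {β : ℝ} (hβ : β ≠ 0) (μ : ℝ) (K : TrigPolyC4v) (Λ Λ' : ℝ)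
    (F : Fin N → FreqMomentum L M → ℂ) (w : TorusSite 2 L → ℝ) (hw0 : ∀ z, 0 ≤ w z) (hw : ∀ b, w (-b) = w b)
    (X : SpaceTimeIdx L M × SectorLeg N) (t : ImagTimeIdx M) (ℓ : SectorLeg N) {T : ℝ}
    (hT : ∀ z₁ : TorusSite 1 (2 * M), ∑ z₂ : TorusSite 2 L, w z₂ *
        ‖∑ q : TorusSite 1 (2 * M) × TorusSite 2 L, (torusChar q.1 z₁ * torusChar q.2 z₂) •
          ((((1 / (β * (L : ℝ) ^ 2) : ℝ) : ℂ) ^ 2 *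
            (F X.2.1.1 (⟨(q.1 0).val, ZMod.val_lt (q.1 0)⟩, q.2) * F ℓ.1.1 (⟨(q.1 0).val, ZMod.val_lt (q.1 0)⟩, q.2) *
              sliceSymbolFnXi (β * (L : ℝ) ^ 2) 0 Λ Λ' (matsubaraFreq β M ⟨(q.1 0).val, ZMod.val_lt (q.1 0)⟩)
                (nambuXiCT L μ K q.2))))‖ ≤ T) :
    ∑ y : TorusSite 2 L,
        ‖((sectorSubMatrix L M β F).transpose * hubbardCovSliceCT L M β μ 0 K Λ Λ' * sectorSubMatrix L M β F) X ((t, y), ℓ)‖ *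
          w (X.1.2 - y) ≤ 2 * T := by
  classical
  rw [hubbardCovSliceCT_eq_normalCovariance_sliceSymbolFnXi hβ μ K Λ Λ']
  set p : FreqMomentum L M × Fin 2 → ℂ := fun ks =>
    sliceSymbolFnXi (β * (L : ℝ) ^ 2) 0 Λ Λ' (matsubaraFreq β M ks.1.1) (nambuXiCT L μ K ks.1.2) with hp
  -- the fixed-time character-sum norm as a function of the two differences
  set Tf : TorusSite 1 (2 * M) → TorusSite 2 L → ℝ := fun z₁ z₂ =>
    ‖∑ q : TorusSite 1 (2 * M) × TorusSite 2 L, (torusChar q.1 z₁ * torusChar q.2 z₂) •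
      ((((1 / (β * (L : ℝ) ^ 2) : ℝ) : ℂ) ^ 2 *
        (F X.2.1.1 (⟨(q.1 0).val, ZMod.val_lt (q.1 0)⟩, q.2) * F ℓ.1.1 (⟨(q.1 0).val, ZMod.val_lt (q.1 0)⟩, q.2) *
          p ((⟨(q.1 0).val, ZMod.val_lt (q.1 0)⟩, q.2), X.2.1.2))))‖ with hTf
  have hT' : ∀ z₁, ∑ z₂, w z₂ * Tf z₁ z₂ ≤ T := fun z₁ => hT z₁
  -- the two time differences (the two orientations)
  set zp : TorusSite 1 (2 * M) := fun _ : Fin 1 => ((X.1.1 : ℕ) : ZMod (2 * M)) - ((t : ℕ) : ZMod (2 * M)) with hzp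
  set zm : TorusSite 1 (2 * M) := fun _ : Fin 1 => ((t : ℕ) : ZMod (2 * M)) - ((X.1.1 : ℕ) : ZMod (2 * M)) with hzm
  calc ∑ y : TorusSite 2 L,
        ‖((sectorSubMatrix L M β F).transpose * normalCovariance L M p * sectorSubMatrix L M β F) X ((t, y), ℓ)‖ * w (X.1.2 - y)
      ≤ ∑ y : TorusSite 2 L, (Tf zp (X.1.2 - y) + Tf zm (y - X.1.2)) * w (X.1.2 - y) :=
        Finset.sum_le_sum fun y _ => mul_le_mul_of_nonneg_right (norm_pullback_normalCovariance_le hβ F p X ((t, y), ℓ)) (hw0 _)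
    _ = ∑ y : TorusSite 2 L, (w (X.1.2 - y) * Tf zp (X.1.2 - y) + w (y - X.1.2) * Tf zm (y - X.1.2)) := by
        refine Finset.sum_congr rfl fun y _ => ?_
        rw [show w (y - X.1.2) = w (X.1.2 - y) by rw [← hw (y - X.1.2), neg_sub]]
        ring
    _ = ∑ z₂ : TorusSite 2 L, w z₂ * Tf zp z₂ + ∑ z₂ : TorusSite 2 L, w z₂ * Tf zm z₂ := by
        rw [Finset.sum_add_distrib]
        congr 1
        · exact Fintype.sum_equiv (Equiv.subLeft X.1.2) _ _ fun y => rfl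
        · exact Fintype.sum_equiv (Equiv.subRight X.1.2) _ _ fun y => rfl
    _ ≤ T + T := add_le_add (hT' zp) (hT' zm)
    _ = 2 * T := by ring

end Generic

/-! ### §2 The fat family: the Λ-scaled sectional row from a uniform rate-weighted sectional per-pair bound -/

section Fat

variable {L M : ℕ} [NeZero L] [NeZero M]

omit [NeZero M] in
/-- **The Λ-scaled site weight is dominated by the spatial rate weight**: `1 + Λ_w·tnorm(z) ≤ D·(1 + s₁|z̃₁| + s₁|z̃₂|)` for `0 ≤ Λ_w ≤ D·s₁`,
`1 ≤ D` (the periodic `ℓ^∞` norm is at most the centred `ℓ¹` norm). [folklore] -/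
theorem one_add_mul_tnorm_le_mul_rateWt {s₁ Λw D : ℝ} (hD : 1 ≤ D) (hΛw : 0 ≤ Λw) (hd₁ : Λw ≤ D * s₁) (z : TorusSite 2 L) :
    1 + Λw * (Torus.tnorm z : ℝ) ≤ D * (1 + s₁ * |(((z 0).valMinAbs : ℤ) : ℝ)| + s₁ * |(((z 1).valMinAbs : ℤ) : ℝ)|) := by
  have ht : (Torus.tnorm z : ℝ) ≤ |(((z 0).valMinAbs : ℤ) : ℝ)| + |(((z 1).valMinAbs : ℤ) : ℝ)| := by
    have h := torusSiteDist_le_abs_add_abs z 0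
    rw [← tnorm_sub_eq_torusSiteDist, sub_zero] at h
    exact h
  have h0 := abs_nonneg (((z 0).valMinAbs : ℤ) : ℝ)
  have h1 := abs_nonneg (((z 1).valMinAbs : ℤ) : ℝ)
  have h2 : Λw * (Torus.tnorm z : ℝ) ≤ D * s₁ * (|(((z 0).valMinAbs : ℤ) : ℝ)| + |(((z 1).valMinAbs : ℤ) : ℝ)|) :=
    (mul_le_mul_of_nonneg_left ht hΛw).trans (mul_le_mul_of_nonneg_right hd₁ (by positivity))
  have e : D * (1 + s₁ * |(((z 0).valMinAbs : ℤ) : ℝ)| + s₁ * |(((z 1).valMinAbs : ℤ) : ℝ)|) =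
      D + D * s₁ * (|(((z 0).valMinAbs : ℤ) : ℝ)| + |(((z 1).valMinAbs : ℤ) : ℝ)|) := by ring
  rw [e]
  linarith

/-- **The Λ-scaled SECTIONAL row for the fat family from a uniform rate-weighted sectional per-pair bound**: if every pair `(ω, ω′)` at angular
scale `m+1` obeys `Σ_{z₂} (1 + s₁|z̃₂,₁| + s₁|z̃₂,₂|)·‖S[(βL²)⁻²F̃_ωF̃_{ω′}Ψ̂](z₁,z₂)‖ ≤ T` for EVERY `z₁`, and `0 ≤ Λ_w ≤ D·s₁`, `1 ≤ D`, then for every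
leg `X`, time slice `t` and label `ℓ`: `Σ_y ‖(S(F̃)ᵀ C^K_{(Λ,Λ′]} S(F̃)) X ((t,y),ℓ)‖·(1 + Λ_w·tnorm(x⃗ − y)) ≤ 2·(D·T)`.
[cite: BenfattoGiulianiMastropietro2006, §2.8 (2.81), §3 (3.3)] -/
theorem secRowWt_sliceCT_bgmFat_le_of_pairBound {β : ℝ} (hβ : 0 < β) (μ : ℝ) (K : TrigPolyC4v) (Λ Λ' e₀ : ℝ) (m : ℕ)
    {s₁ Λw D T : ℝ} (hD : 1 ≤ D) (hΛw : 0 ≤ Λw) (hd₁ : Λw ≤ D * s₁)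
    (hT : ∀ ω ω' : Fin (sectorCount (m + 1)), ∀ z₁ : TorusSite 1 (2 * M), ∑ z₂ : TorusSite 2 L,
        (1 + s₁ * |(((z₂ 0).valMinAbs : ℤ) : ℝ)| + s₁ * |(((z₂ 1).valMinAbs : ℤ) : ℝ)|) *
        ‖∑ q : TorusSite 1 (2 * M) × TorusSite 2 L, (torusChar q.1 z₁ * torusChar q.2 z₂) •
          ((((1 / (β * (L : ℝ) ^ 2) : ℝ) : ℂ) ^ 2 *
            (bgmFatMultiplier L M e₀ β (nambuXiCT L μ K) (m + 1) ω (⟨(q.1 0).val, ZMod.val_lt (q.1 0)⟩, q.2) *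
              bgmFatMultiplier L M e₀ β (nambuXiCT L μ K) (m + 1) ω' (⟨(q.1 0).val, ZMod.val_lt (q.1 0)⟩, q.2) *
              sliceSymbolFnXi (β * (L : ℝ) ^ 2) 0 Λ Λ' (matsubaraFreq β M ⟨(q.1 0).val, ZMod.val_lt (q.1 0)⟩)
                (nambuXiCT L μ K q.2))))‖ ≤ T)
    (X : SpaceTimeIdx L M × SectorLeg (sectorCount (m + 1))) (t : ImagTimeIdx M) (ℓ : SectorLeg (sectorCount (m + 1))) :
    ∑ y : TorusSite 2 L,
        ‖((sectorSubMatrix L M β (bgmFatMultiplier L M e₀ β (nambuXiCT L μ K) (m + 1))).transpose *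
            hubbardCovSliceCT L M β μ 0 K Λ Λ' * sectorSubMatrix L M β (bgmFatMultiplier L M e₀ β (nambuXiCT L μ K) (m + 1))) X ((t, y), ℓ)‖ *
          (1 + Λw * (Torus.tnorm (X.1.2 - y) : ℝ)) ≤
      2 * (D * T) := by
  have hD0 : 0 ≤ D := zero_le_one.trans hD
  refine secRowWt_norm_pullback_sliceCT_le hβ.ne' μ K Λ Λ' _ (fun z : TorusSite 2 L => 1 + Λw * (Torus.tnorm z : ℝ))
    (fun z => by positivity) (fun b => by rw [le_antisymm (Torus.tnorm_neg_le b) (by simpa using Torus.tnorm_neg_le (-b))]) X t ℓ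
    fun z₁ => ?_
  calc ∑ z₂ : TorusSite 2 L, (1 + Λw * (Torus.tnorm z₂ : ℝ)) *
        ‖∑ q : TorusSite 1 (2 * M) × TorusSite 2 L, (torusChar q.1 z₁ * torusChar q.2 z₂) •
          ((((1 / (β * (L : ℝ) ^ 2) : ℝ) : ℂ) ^ 2 *
            (bgmFatMultiplier L M e₀ β (nambuXiCT L μ K) (m + 1) X.2.1.1 (⟨(q.1 0).val, ZMod.val_lt (q.1 0)⟩, q.2) *
              bgmFatMultiplier L M e₀ β (nambuXiCT L μ K) (m + 1) ℓ.1.1 (⟨(q.1 0).val, ZMod.val_lt (q.1 0)⟩, q.2) *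
              sliceSymbolFnXi (β * (L : ℝ) ^ 2) 0 Λ Λ' (matsubaraFreq β M ⟨(q.1 0).val, ZMod.val_lt (q.1 0)⟩)
                (nambuXiCT L μ K q.2))))‖
      ≤ ∑ z₂ : TorusSite 2 L, (D * (1 + s₁ * |(((z₂ 0).valMinAbs : ℤ) : ℝ)| + s₁ * |(((z₂ 1).valMinAbs : ℤ) : ℝ)|)) *
        ‖∑ q : TorusSite 1 (2 * M) × TorusSite 2 L, (torusChar q.1 z₁ * torusChar q.2 z₂) •
          ((((1 / (β * (L : ℝ) ^ 2) : ℝ) : ℂ) ^ 2 *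
            (bgmFatMultiplier L M e₀ β (nambuXiCT L μ K) (m + 1) X.2.1.1 (⟨(q.1 0).val, ZMod.val_lt (q.1 0)⟩, q.2) *
              bgmFatMultiplier L M e₀ β (nambuXiCT L μ K) (m + 1) ℓ.1.1 (⟨(q.1 0).val, ZMod.val_lt (q.1 0)⟩, q.2) *
              sliceSymbolFnXi (β * (L : ℝ) ^ 2) 0 Λ Λ' (matsubaraFreq β M ⟨(q.1 0).val, ZMod.val_lt (q.1 0)⟩)
                (nambuXiCT L μ K q.2))))‖ :=
        Finset.sum_le_sum fun z₂ _ => mul_le_mul_of_nonneg_right (one_add_mul_tnorm_le_mul_rateWt hD hΛw hd₁ z₂) (norm_nonneg _)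
    _ = D * ∑ z₂ : TorusSite 2 L, (1 + s₁ * |(((z₂ 0).valMinAbs : ℤ) : ℝ)| + s₁ * |(((z₂ 1).valMinAbs : ℤ) : ℝ)|) *
        ‖∑ q : TorusSite 1 (2 * M) × TorusSite 2 L, (torusChar q.1 z₁ * torusChar q.2 z₂) •
          ((((1 / (β * (L : ℝ) ^ 2) : ℝ) : ℂ) ^ 2 *
            (bgmFatMultiplier L M e₀ β (nambuXiCT L μ K) (m + 1) X.2.1.1 (⟨(q.1 0).val, ZMod.val_lt (q.1 0)⟩, q.2) *
              bgmFatMultiplier L M e₀ β (nambuXiCT L μ K) (m + 1) ℓ.1.1 (⟨(q.1 0).val, ZMod.val_lt (q.1 0)⟩, q.2) *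
              sliceSymbolFnXi (β * (L : ℝ) ^ 2) 0 Λ Λ' (matsubaraFreq β M ⟨(q.1 0).val, ZMod.val_lt (q.1 0)⟩)
                (nambuXiCT L μ K q.2))))‖ := by
        rw [Finset.mul_sum]; exact Finset.sum_congr rfl fun z₂ _ => by ring
    _ ≤ D * T := mul_le_mul_of_nonneg_left (hT X.2.1.1 ℓ.1.1 z₁) hD0

end Fat

end Summit.HubbardSuperconductivity.HubbardSuperconductivity.Theorems.TorusFourierL2

end
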